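import Summits.NavierStokesRegularity.NavierStokesRegularity.Theses.AxisymmetricExtremality
import Summits.NavierStokesRegularity.NavierStokesRegularity.Theorems.AxisymmetricExtremalityAxisymmetricKatoGlobalStubSeregin2020TypeIIAncientLimit
import Literature.Analysis.FluidPDE.AxisymPoloidalPart
import Literature.Analysis.FluidPDE.SuitableWeakCongr
import Literature.Analysis.FluidPDE.LocalTypeICongr
import HarnessLib

/-!
# Seregin 2020, proof of Thm 2.1, the no-swirl endgame: the swirl-free normal form of the
# blow-up limit and the contradiction with (2.9)

Helper toward the stub `stub_seregin2020TypeII` of the crux `AxisymmetricKatoGlobal` (= the named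
fact `Literature.Analysis.FluidPDE.Seregin2020_axisymmetricSingularPoint_typeII`, G. Seregin,
Anal. Math. Phys. 10 (2020) Paper 46 = arXiv:2006.04140, Thm 2.1), second half of the printed
proof (arXiv p. 8): "using standard arguments, we easily deduce from Lemma 2.2 that `Γ = 0` and,
therefore, `u_φ = 0`, i.e., `u = u_ϱ e_ϱ + u₃ e₃`. … any axially symmetric suitable weak solution
with no swirl … is smooth … In particular, the function `u` is a continuous function in `Q̄(R)`
for any `R > 0`. The latter contradicts restriction (2.9) for sufficiently small `a`."

Two unconditional pieces of this endgame are recorded here, for the blow-up limit `(w, π)` with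
the properties (𝒜)(i)–(iii), (2.9) delivered by `exists_ancientLimit_isAxisymmetric`:

* **the swirl-free normal form** (`ancientLimit_poloidalPart`,
  `exists_ancientLimit_hasNoSwirl_repr`):
  once `Γ = swirl (w s) = 0` almost everywhere on every `Q(a)` (the output of the `Γ ≡ 0` step),
  the poloidal part `s ↦ poloidalPart (w s) = w s - u_φ e_φ` is a representative of `w` which is
  swirl free AND axisymmetric at EVERY point (the form consumed by the tree's no-swirl tools
  `HasNoSwirl`, `noSwirl_abs_scalar_le_of_boundary`, …), a.e. equal to `w` on every `Q(a)`, with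
  the origin still a backward singular point and the whole property block (𝒜)(i)–(iii), (2.9)
  (suitability, `L³` class, the two convergences, `A, C, D ≤ K`, `A + E ≤ K`, `C ≥ κ`) intact;
* **the contradiction with (2.9)** (`cknC_le_of_ae_enorm_le`, `tendsto_cknC_of_eLpNorm_lt_top`,
  `false_of_le_cknC_of_eLpNorm_lt_top`): if `w` is essentially bounded on some `Q(r)`, then
  `C(w; a) = a⁻² ∫_{Q(a)} |w|³ ≤ M³ a³ |B₁| → 0` as `a → 0⁺`, contradicting `C(w; a) ≥ κ > 0`;
  and the same boundedness contradicts `IsBackwardSingularPoint w 0` directly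
  (`not_isBackwardSingularPoint_of_eLpNorm_lt_top`).

What remains between the two pieces is the regularity statement "(𝒜) ∧ swirl free ⇒ `w` bounded
on some `Q(r)`" (Kang 2004 / the `η = ω_φ/ϱ` reduction to dimension 5), not in the tree.

## References

* G. Seregin, Anal. Math. Phys. 10 (2020), Paper 46 = arXiv:2006.04140, proof of Thm. 2.1, last
  paragraph (arXiv p. 8), with (2.9) (p. 7). [Seregin2020]
-/

-- the problem directory repeats the summit name (D-0017); core's `dupNamespace` linter fires
set_option linter.dupNamespace false

noncomputable section

open MeasureTheory Set Function Filter Topology TopologicalSpace Metric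
open scoped NNReal ENNReal

namespace Summit.NavierStokesRegularity.NavierStokesRegularity.Theorems.AxisymmetricKatoGlobal.EulerScaling

open Literature.Analysis.FluidPDE Literature.Analysis.FluidPDE.Seregin2020

/-! ### The contradiction with (2.9): a bounded field has `C(a) → 0` -/

/-- **An essential bound gives `C(w; a) ≤ M³ a³ |B₁|`**: if `‖w‖ ≤ M` a.e. on `Q(r)` then for
`0 < a ≤ r`, `C(w; a) = a⁻² ∫_{Q(a)} |w|³ ≤ a⁻² M³ |Q(a)| = M³ a³ |B₁|` (`|Q(a)| = a⁵|B₁|`; the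
estimate behind
"`u` continuous in `Q̄(R)` contradicts (2.9) for sufficiently small `a`").
[cite: Seregin2020, proof of Thm 2.1, last paragraph] -/
theorem cknC_le_of_ae_enorm_le
    {w : ℝ → EuclideanSpace ℝ (Fin 3) → EuclideanSpace ℝ (Fin 3)} {r a : ℝ} {M : ℝ≥0∞}
    (hM : ∀ᵐ z ∂(volume.restrict (parabolicCylinder r (0 : ℝ × EuclideanSpace ℝ (Fin 3)))),
      ‖w z.1 z.2‖ₑ ≤ M)
    (ha : 0 < a) (har : a ≤ r) :
    cknC a (0 : ℝ × EuclideanSpace ℝ (Fin 3)) w ≤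
      M ^ 3 * ENNReal.ofReal (a ^ 3) * volume (ball (0 : EuclideanSpace ℝ (Fin 3)) 1) := by
  have hM' : ∀ᵐ z ∂(volume.restrict (parabolicCylinder a (0 : ℝ × EuclideanSpace ℝ (Fin 3)))),
      ‖w z.1 z.2‖ₑ ≤ M :=
    ae_restrict_of_ae_restrict_of_subset (parabolicCylinder_zero_mono ha.le har) hM
  have h1 : ∫⁻ z in parabolicCylinder a (0 : ℝ × EuclideanSpace ℝ (Fin 3)), ‖w z.1 z.2‖ₑ ^ (3 : ℕ) ≤
      ∫⁻ _ in parabolicCylinder a (0 : ℝ × EuclideanSpace ℝ (Fin 3)), M ^ 3 :=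
    lintegral_mono_ae (hM'.mono fun z hz => pow_le_pow_left₀ (by positivity) hz 3)
  -- `|Q(a)| = a⁵ |B₁|` (`volume_parabolicCylinder`)
  rw [setLIntegral_const, volume_parabolicCylinder ha] at h1
  have ha2 : ENNReal.ofReal a ^ 2 ≠ 0 := pow_ne_zero 2 (ENNReal.ofReal_pos.2 ha).ne'
  have ha2' : ENNReal.ofReal a ^ 2 ≠ ∞ := ENNReal.pow_ne_top ENNReal.ofReal_ne_top
  unfold cknC
  calc (ENNReal.ofReal a ^ 2)⁻¹ *
        ∫⁻ z in parabolicCylinder a (0 : ℝ × EuclideanSpace ℝ (Fin 3)), ‖w z.1 z.2‖ₑ ^ (3 : ℕ)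
      ≤ (ENNReal.ofReal a ^ 2)⁻¹ * (M ^ 3 * (ENNReal.ofReal (a ^ 5) *
          volume (ball (0 : EuclideanSpace ℝ (Fin 3)) 1))) := by
        gcongr
    _ = M ^ 3 * ENNReal.ofReal (a ^ 3) * volume (ball (0 : EuclideanSpace ℝ (Fin 3)) 1) := by
        rw [ENNReal.ofReal_pow ha.le, ENNReal.ofReal_pow ha.le]
        calc (ENNReal.ofReal a ^ 2)⁻¹ * (M ^ 3 * (ENNReal.ofReal a ^ 5 *
              volume (ball (0 : EuclideanSpace ℝ (Fin 3)) 1)))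
            = ((ENNReal.ofReal a ^ 2)⁻¹ * ENNReal.ofReal a ^ 2) * (M ^ 3 * ENNReal.ofReal a ^ 3 *
                volume (ball (0 : EuclideanSpace ℝ (Fin 3)) 1)) := by
              ring
          _ = M ^ 3 * ENNReal.ofReal a ^ 3 * volume (ball (0 : EuclideanSpace ℝ (Fin 3)) 1) := by
              rw [ENNReal.inv_mul_cancel ha2 ha2', one_mul]

/-- **"`u` bounded near the origin contradicts (2.9) for small `a`", limit form**: if `w` is
essentially bounded on some `Q(r)`, `r > 0`, then `C(w; a) → 0` as `a → 0⁺`.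
[cite: Seregin2020, proof of Thm 2.1, last paragraph] -/
theorem tendsto_cknC_of_eLpNorm_lt_top
    {w : ℝ → EuclideanSpace ℝ (Fin 3) → EuclideanSpace ℝ (Fin 3)} {r : ℝ} (hr : 0 < r)
    (hfin : eLpNorm (uncurry w) ∞
      (volume.restrict (parabolicCylinder r (0 : ℝ × EuclideanSpace ℝ (Fin 3)))) < ∞) :
    Tendsto (fun a : ℝ => cknC a (0 : ℝ × EuclideanSpace ℝ (Fin 3)) w) (𝓝[>] 0) (𝓝 0) := by
  set M : ℝ≥0∞ := eLpNorm (uncurry w) ∞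
    (volume.restrict (parabolicCylinder r (0 : ℝ × EuclideanSpace ℝ (Fin 3)))) with hMdef
  have hM : ∀ᵐ z ∂(volume.restrict (parabolicCylinder r (0 : ℝ × EuclideanSpace ℝ (Fin 3)))),
      ‖w z.1 z.2‖ₑ ≤ M := by
    filter_upwards [ae_le_eLpNormEssSup (f := uncurry w)
      (μ := volume.restrict (parabolicCylinder r (0 : ℝ × EuclideanSpace ℝ (Fin 3))))] with z hz
    rw [← eLpNorm_exponent_top] at hz
    exact hz
  set V : ℝ≥0∞ := volume (ball (0 : EuclideanSpace ℝ (Fin 3)) 1) with hVdef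
  have hV : V ≠ ∞ := measure_ball_lt_top.ne
  have hM3 : M ^ 3 ≠ ∞ := ENNReal.pow_ne_top hfin.ne
  -- the majorant `M³ a³ |B₁| → 0`
  have hg : Tendsto (fun a : ℝ => M ^ 3 * ENNReal.ofReal (a ^ 3) * V) (𝓝[>] 0) (𝓝 0) := by
    have h0 : Tendsto (fun a : ℝ => ENNReal.ofReal (a ^ 3)) (𝓝[>] 0) (𝓝 0) := by
      have hc : Tendsto (fun a : ℝ => a ^ 3) (𝓝 (0 : ℝ)) (𝓝 0) := by
        simpa using (continuous_pow 3).tendsto (0 : ℝ)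
      simpa using (ENNReal.tendsto_ofReal hc).mono_left nhdsWithin_le_nhds
    have h1 : Tendsto (fun a : ℝ => M ^ 3 * ENNReal.ofReal (a ^ 3)) (𝓝[>] 0) (𝓝 0) := by
      simpa using ENNReal.Tendsto.const_mul h0 (Or.inr hM3)
    simpa using ENNReal.Tendsto.mul_const h1 (Or.inr hV)
  have hle : ∀ᶠ a in 𝓝[>] (0 : ℝ), cknC a (0 : ℝ × EuclideanSpace ℝ (Fin 3)) w ≤
      M ^ 3 * ENNReal.ofReal (a ^ 3) * V := by
    filter_upwards [Ioc_mem_nhdsGT hr] with a ha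
    exact cknC_le_of_ae_enorm_le hM ha.1 ha.2
  exact tendsto_of_tendsto_of_tendsto_of_le_of_le' tendsto_const_nhds hg
    (Eventually.of_forall fun _ => bot_le) hle

/-- **Seregin 2020, proof of Thm 2.1, the final contradiction**: a field which is essentially
bounded on some `Q(r)` ("`u` is a continuous function in `Q̄(R)`") cannot satisfy the
non-triviality (2.9) `C(w; a) ≥ κ > 0` for all small `a > 0`.
[cite: Seregin2020, proof of Thm 2.1, last paragraph] -/
theorem false_of_le_cknC_of_eLpNorm_lt_top :
    ∀ (w : ℝ → EuclideanSpace ℝ (Fin 3) → EuclideanSpace ℝ (Fin 3)) (κ r : ℝ), 0 < κ →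
      (∀ a : ℝ, 0 < a → a ≤ r → ENNReal.ofReal κ ≤ cknC a (0 : ℝ × EuclideanSpace ℝ (Fin 3)) w) →
      0 < r → eLpNorm (uncurry w) ∞
        (volume.restrict (parabolicCylinder r (0 : ℝ × EuclideanSpace ℝ (Fin 3)))) < ∞ → False := by
  intro w κ r hκ hC hr hfin
  have ht := tendsto_cknC_of_eLpNorm_lt_top hr hfin
  have hκ' : (0 : ℝ≥0∞) < ENNReal.ofReal κ := ENNReal.ofReal_pos.2 hκ
  have hev : ∀ᶠ a in 𝓝[>] (0 : ℝ),
      cknC a (0 : ℝ × EuclideanSpace ℝ (Fin 3)) w < ENNReal.ofReal κ ∧ a ∈ Ioc (0 : ℝ) r :=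
    (ht.eventually (gt_mem_nhds hκ')).and (Ioc_mem_nhdsGT hr)
  obtain ⟨a, hlt, ha⟩ := hev.exists
  exact (lt_irrefl _) ((hC a ha.1 ha.2).trans_lt hlt)

/-- Essential boundedness on one `Q(r)` excludes a backward singular point at the origin
(definitional form of the contradiction). [folklore] -/
theorem not_isBackwardSingularPoint_of_eLpNorm_lt_top :
    ∀ (w : ℝ → EuclideanSpace ℝ (Fin 3) → EuclideanSpace ℝ (Fin 3)) (r : ℝ), 0 < r →
      eLpNorm (uncurry w) ∞
        (volume.restrict (parabolicCylinder r (0 : ℝ × EuclideanSpace ℝ (Fin 3)))) < ∞ →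
      ¬ IsBackwardSingularPoint w 0 := fun w r hr hfin hsing => by
  have h := hsing r hr
  rw [h] at hfin
  exact lt_irrefl _ hfin

/-! ### The swirl-free normal form: the poloidal part of the limit -/

/-- Where the swirl vanishes the poloidal part is the field itself:
`swirl u y = 0 → poloidalPart u y = u y` (`V^a = V - (Γ/ϱ²) J`). [folklore] -/
theorem poloidalPart_eq_self_of_swirl_eq_zero
    {u : EuclideanSpace ℝ (Fin 3) → EuclideanSpace ℝ (Fin 3)} {y : EuclideanSpace ℝ (Fin 3)}
    (h : swirl u y = 0) : poloidalPart u y = u y := by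
  rw [poloidalPart_eq_sub_smul_rotGen, h, zero_div, zero_smul, sub_zero]

/-- The poloidal part of an axisymmetric field is axisymmetric. [folklore] -/
theorem isAxisymmetric_poloidalPart
    {u : EuclideanSpace ℝ (Fin 3) → EuclideanSpace ℝ (Fin 3)} (hu : IsAxisymmetric u) :
    IsAxisymmetric (poloidalPart u) :=
  fun θ y => poloidalPart_rotZ (hu θ y)

/-- A field whose swirl vanishes a.e. on every `Q(a)` agrees a.e. on every `Q(a)` with its
(slicewise) poloidal part. [folklore] -/
theorem ae_poloidalPart_eq_of_ae_swirl_eq_zero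
    {w : ℝ → EuclideanSpace ℝ (Fin 3) → EuclideanSpace ℝ (Fin 3)}
    (hsw : ∀ a : ℝ, 0 < a →
      ∀ᵐ z ∂(volume.restrict (parabolicCylinder a (0 : ℝ × EuclideanSpace ℝ (Fin 3)))),
        swirl (w z.1) z.2 = 0)
    {a : ℝ} (ha : 0 < a) :
    ∀ᵐ z ∂(volume.restrict (parabolicCylinder a (0 : ℝ × EuclideanSpace ℝ (Fin 3)))),
      uncurry w z = uncurry (fun s y => poloidalPart (w s) y) z := by
  filter_upwards [hsw a ha] with z hz
  simp only [uncurry, poloidalPart_eq_self_of_swirl_eq_zero hz]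

/-- **Seregin 2020, proof of Thm 2.1: the swirl-free normal form of the blow-up limit.** Let
`(w, π)` have the properties (𝒜)(i)–(iii) and (2.9) in the form delivered by
`exists_ancientLimit_isAxisymmetric` (every slice `w s` axisymmetric, backward singular origin,
and for every `a > 0` the block: suitable in `Q(a)`, `w ∈ L³(Q(a))` as the strong limit of the
rescaled velocities, `π` the weak `L^{3/2}` limit of the rescaled pressures, `A, C, D ≤ K`,
`A + E ≤ K`, `C ≥ κ`), and suppose the swirl `Γ = swirl (w s)` vanishes a.e. on every `Q(a)`
("`Γ = 0` and, therefore, `u_φ = 0`, i.e., `u = u_ϱ e_ϱ + u₃ e₃`"). Then the poloidal part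
`s ↦ poloidalPart (w s)` is axisymmetric and swirl free at EVERY point, the origin is still a
backward singular point, and the whole block holds for it with the same `K`, `κ`, scales and
pressure. [cite: Seregin2020, proof of Thm 2.1, last paragraph] -/
theorem ancientLimit_poloidalPart
    {u w : ℝ → EuclideanSpace ℝ (Fin 3) → EuclideanSpace ℝ (Fin 3)}
    {p π : ℝ → EuclideanSpace ℝ (Fin 3) → ℝ} {K : ℝ≥0} {κ : ℝ} {lam : ℕ → ℝ}
    (hax : ∀ s, IsAxisymmetric (w s)) (hsing : IsBackwardSingularPoint w 0)
    (hall : ∀ a : ℝ, 0 < a →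
        IsSuitableWeakSolutionInBall a 0 w π ∧
        MemLp (uncurry w) 3
          (volume.restrict (parabolicCylinder a (0 : ℝ × EuclideanSpace ℝ (Fin 3)))) ∧
        Tendsto (fun j => eLpNorm
            (uncurry ((lam j) • stPull ((lam j) ^ 2) (lam j) (0 : ℝ)
              (0 : EuclideanSpace ℝ (Fin 3)) u) - uncurry w) 3
            (volume.restrict (parabolicCylinder a (0 : ℝ × EuclideanSpace ℝ (Fin 3)))))
          atTop (𝓝 0) ∧
        (∀ g : ℝ × EuclideanSpace ℝ (Fin 3) → ℝ,
          MemLp g 3 (volume.restrict (parabolicCylinder a (0 : ℝ × EuclideanSpace ℝ (Fin 3)))) →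
          Tendsto (fun j => ∫ w' in parabolicCylinder a (0 : ℝ × EuclideanSpace ℝ (Fin 3)),
              ((lam j) ^ 2 • stPull ((lam j) ^ 2) (lam j) (0 : ℝ)
                (0 : EuclideanSpace ℝ (Fin 3)) p) w'.1 w'.2 * g w')
            atTop (𝓝 (∫ w' in parabolicCylinder a (0 : ℝ × EuclideanSpace ℝ (Fin 3)),
              π w'.1 w'.2 * g w'))) ∧
        cknAEss a (0 : ℝ × EuclideanSpace ℝ (Fin 3)) w ≤ K ∧
        cknC a (0 : ℝ × EuclideanSpace ℝ (Fin 3)) w ≤ K ∧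
        cknD a (0 : ℝ × EuclideanSpace ℝ (Fin 3)) π ≤ K ∧
        (∃ G' : ℝ → EuclideanSpace ℝ (Fin 3) →
            EuclideanSpace ℝ (Fin 3) →L[ℝ] EuclideanSpace ℝ (Fin 3),
          HasWeakSpatialGradientOn
              (parabolicCylinderOpens (2 * a) (0 : ℝ × EuclideanSpace ℝ (Fin 3))) w G' ∧
            cknAEss a (0 : ℝ × EuclideanSpace ℝ (Fin 3)) w +
              cknE a (0 : ℝ × EuclideanSpace ℝ (Fin 3)) G' ≤ K) ∧
        ENNReal.ofReal κ ≤ cknC a (0 : ℝ × EuclideanSpace ℝ (Fin 3)) w)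
    (hsw : ∀ a : ℝ, 0 < a →
      ∀ᵐ z ∂(volume.restrict (parabolicCylinder a (0 : ℝ × EuclideanSpace ℝ (Fin 3)))),
        swirl (w z.1) z.2 = 0) :
    (∀ s, IsAxisymmetric (fun y => poloidalPart (w s) y)) ∧
    (∀ s, HasNoSwirl (fun y => poloidalPart (w s) y)) ∧
    IsBackwardSingularPoint (fun s y => poloidalPart (w s) y) 0 ∧
    ∀ a : ℝ, 0 < a →
      IsSuitableWeakSolutionInBall a 0 (fun s y => poloidalPart (w s) y) π ∧
      MemLp (uncurry (fun s y => poloidalPart (w s) y)) 3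
        (volume.restrict (parabolicCylinder a (0 : ℝ × EuclideanSpace ℝ (Fin 3)))) ∧
      Tendsto (fun j => eLpNorm
          (uncurry ((lam j) • stPull ((lam j) ^ 2) (lam j) (0 : ℝ)
            (0 : EuclideanSpace ℝ (Fin 3)) u) - uncurry (fun s y => poloidalPart (w s) y)) 3
          (volume.restrict (parabolicCylinder a (0 : ℝ × EuclideanSpace ℝ (Fin 3)))))
        atTop (𝓝 0) ∧
      (∀ g : ℝ × EuclideanSpace ℝ (Fin 3) → ℝ,
        MemLp g 3 (volume.restrict (parabolicCylinder a (0 : ℝ × EuclideanSpace ℝ (Fin 3)))) →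
        Tendsto (fun j => ∫ w' in parabolicCylinder a (0 : ℝ × EuclideanSpace ℝ (Fin 3)),
            ((lam j) ^ 2 • stPull ((lam j) ^ 2) (lam j) (0 : ℝ)
              (0 : EuclideanSpace ℝ (Fin 3)) p) w'.1 w'.2 * g w')
          atTop (𝓝 (∫ w' in parabolicCylinder a (0 : ℝ × EuclideanSpace ℝ (Fin 3)),
            π w'.1 w'.2 * g w'))) ∧
      cknAEss a (0 : ℝ × EuclideanSpace ℝ (Fin 3)) (fun s y => poloidalPart (w s) y) ≤ K ∧
      cknC a (0 : ℝ × EuclideanSpace ℝ (Fin 3)) (fun s y => poloidalPart (w s) y) ≤ K ∧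
      cknD a (0 : ℝ × EuclideanSpace ℝ (Fin 3)) π ≤ K ∧
      (∃ G' : ℝ → EuclideanSpace ℝ (Fin 3) →
          EuclideanSpace ℝ (Fin 3) →L[ℝ] EuclideanSpace ℝ (Fin 3),
        HasWeakSpatialGradientOn
            (parabolicCylinderOpens (2 * a) (0 : ℝ × EuclideanSpace ℝ (Fin 3)))
            (fun s y => poloidalPart (w s) y) G' ∧
          cknAEss a (0 : ℝ × EuclideanSpace ℝ (Fin 3)) (fun s y => poloidalPart (w s) y) +
            cknE a (0 : ℝ × EuclideanSpace ℝ (Fin 3)) G' ≤ K) ∧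
      ENNReal.ofReal κ ≤
        cknC a (0 : ℝ × EuclideanSpace ℝ (Fin 3)) (fun s y => poloidalPart (w s) y) := by
  set w' : ℝ → EuclideanSpace ℝ (Fin 3) → EuclideanSpace ℝ (Fin 3) :=
    fun s y => poloidalPart (w s) y with hw'
  have hww' : ∀ a : ℝ, 0 < a →
      ∀ᵐ z ∂(volume.restrict (parabolicCylinder a (0 : ℝ × EuclideanSpace ℝ (Fin 3)))),
        uncurry w z = uncurry w' z := fun a ha => ae_poloidalPart_eq_of_ae_swirl_eq_zero hsw ha
  refine ⟨fun s => isAxisymmetric_poloidalPart (hax s), fun s => hasNoSwirl_poloidalPart (w s),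
    ?_, fun a ha => ?_⟩
  · -- the origin stays singular
    refine hsing.congr_ae (S := {z : ℝ × EuclideanSpace ℝ (Fin 3) | z.1 < 0})
      (fun r hr z hz => ?_) (ae_restrict_halfSpace_of_forall hww')
    rw [mem_parabolicCylinder] at hz
    simpa using hz.1.2
  obtain ⟨h1, h2, h3, h4, h5, h6, h7, ⟨G', hG', hG'b⟩, h8⟩ := hall a ha
  have hae : uncurry w =ᵐ[volume.restrict (parabolicCylinder a (0 : ℝ × EuclideanSpace ℝ (Fin 3)))]
      uncurry w' := hww' a ha
  have hC : cknC a (0 : ℝ × EuclideanSpace ℝ (Fin 3)) w' =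
      cknC a (0 : ℝ × EuclideanSpace ℝ (Fin 3)) w := (cknC_congr_ae (hww' a ha)).symm
  have hA : cknAEss a (0 : ℝ × EuclideanSpace ℝ (Fin 3)) w' =
      cknAEss a (0 : ℝ × EuclideanSpace ℝ (Fin 3)) w := (cknAEss_congr_ae (hww' a ha)).symm
  refine ⟨h1.congr_ae' (hww' a ha) (Eventually.of_forall fun _ => rfl), h2.ae_eq hae, ?_, h4,
    ?_, ?_, h7, ⟨G', ?_, ?_⟩, ?_⟩
  · -- strong `L³` convergence of the rescaled velocities
    refine h3.congr fun j => eLpNorm_congr_ae ?_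
    filter_upwards [hae] with z hz
    simp only [Pi.sub_apply, hz]
  · rw [hA]; exact h5
  · rw [hC]; exact h6
  · -- the weak gradient on `Q(2a)` is unchanged
    have h2a : 0 < 2 * a := by positivity
    refine hG'.congr_ae ?_
    rw [coe_parabolicCylinderOpens]
    exact hww' (2 * a) h2a
  · rw [hA]; exact hG'b
  · rw [hC]; exact h8

/-- **The swirl-free normal form, existential packaging.** Under the hypotheses of
`ancientLimit_poloidalPart` there is a representative `w'` of `w` (a.e. equal on every `Q(a)`),
axisymmetric and swirl free at every point, with backward singular origin and, for every
`a > 0`: suitable in `Q(a)`, `w' ∈ L³(Q(a))`, `A, C ≤ K`, `D ≤ K`, `A + E ≤ K` for a weak spatial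
gradient on `Q(2a)`, and `C ≥ κ`. This is the input of the no-swirl regularity step ("any axially
symmetric suitable weak solution with no swirl … is smooth"); its output — `w'` essentially
bounded on some `Q(r)` — is contradictory by `not_isBackwardSingularPoint_of_eLpNorm_lt_top` or
`false_of_le_cknC_of_eLpNorm_lt_top`. [cite: Seregin2020, proof of Thm 2.1, last paragraph] -/
theorem exists_ancientLimit_hasNoSwirl_repr :
    ∀ (u w : ℝ → EuclideanSpace ℝ (Fin 3) → EuclideanSpace ℝ (Fin 3))
      (p π : ℝ → EuclideanSpace ℝ (Fin 3) → ℝ) (K : ℝ≥0) (κ : ℝ) (lam : ℕ → ℝ),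
      (∀ s, IsAxisymmetric (w s)) → IsBackwardSingularPoint w 0 →
      (∀ a : ℝ, 0 < a →
        IsSuitableWeakSolutionInBall a 0 w π ∧
        MemLp (uncurry w) 3
          (volume.restrict (parabolicCylinder a (0 : ℝ × EuclideanSpace ℝ (Fin 3)))) ∧
        Tendsto (fun j => eLpNorm
            (uncurry ((lam j) • stPull ((lam j) ^ 2) (lam j) (0 : ℝ)
              (0 : EuclideanSpace ℝ (Fin 3)) u) - uncurry w) 3
            (volume.restrict (parabolicCylinder a (0 : ℝ × EuclideanSpace ℝ (Fin 3)))))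
          atTop (𝓝 0) ∧
        (∀ g : ℝ × EuclideanSpace ℝ (Fin 3) → ℝ,
          MemLp g 3 (volume.restrict (parabolicCylinder a (0 : ℝ × EuclideanSpace ℝ (Fin 3)))) →
          Tendsto (fun j => ∫ w' in parabolicCylinder a (0 : ℝ × EuclideanSpace ℝ (Fin 3)),
              ((lam j) ^ 2 • stPull ((lam j) ^ 2) (lam j) (0 : ℝ)
                (0 : EuclideanSpace ℝ (Fin 3)) p) w'.1 w'.2 * g w')
            atTop (𝓝 (∫ w' in parabolicCylinder a (0 : ℝ × EuclideanSpace ℝ (Fin 3)),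
              π w'.1 w'.2 * g w'))) ∧
        cknAEss a (0 : ℝ × EuclideanSpace ℝ (Fin 3)) w ≤ K ∧
        cknC a (0 : ℝ × EuclideanSpace ℝ (Fin 3)) w ≤ K ∧
        cknD a (0 : ℝ × EuclideanSpace ℝ (Fin 3)) π ≤ K ∧
        (∃ G' : ℝ → EuclideanSpace ℝ (Fin 3) →
            EuclideanSpace ℝ (Fin 3) →L[ℝ] EuclideanSpace ℝ (Fin 3),
          HasWeakSpatialGradientOn
              (parabolicCylinderOpens (2 * a) (0 : ℝ × EuclideanSpace ℝ (Fin 3))) w G' ∧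
            cknAEss a (0 : ℝ × EuclideanSpace ℝ (Fin 3)) w +
              cknE a (0 : ℝ × EuclideanSpace ℝ (Fin 3)) G' ≤ K) ∧
        ENNReal.ofReal κ ≤ cknC a (0 : ℝ × EuclideanSpace ℝ (Fin 3)) w) →
      (∀ a : ℝ, 0 < a →
        ∀ᵐ z ∂(volume.restrict (parabolicCylinder a (0 : ℝ × EuclideanSpace ℝ (Fin 3)))),
          swirl (w z.1) z.2 = 0) →
    ∃ w' : ℝ → EuclideanSpace ℝ (Fin 3) → EuclideanSpace ℝ (Fin 3),
      (∀ s, IsAxisymmetric (w' s)) ∧ (∀ s, HasNoSwirl (w' s)) ∧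
      IsBackwardSingularPoint w' 0 ∧
      (∀ a : ℝ, 0 < a →
        uncurry w' =ᵐ[volume.restrict (parabolicCylinder a (0 : ℝ × EuclideanSpace ℝ (Fin 3)))]
          uncurry w) ∧
      ∀ a : ℝ, 0 < a →
        IsSuitableWeakSolutionInBall a 0 w' π ∧
        MemLp (uncurry w') 3
          (volume.restrict (parabolicCylinder a (0 : ℝ × EuclideanSpace ℝ (Fin 3)))) ∧
        cknAEss a (0 : ℝ × EuclideanSpace ℝ (Fin 3)) w' ≤ K ∧
        cknC a (0 : ℝ × EuclideanSpace ℝ (Fin 3)) w' ≤ K ∧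
        cknD a (0 : ℝ × EuclideanSpace ℝ (Fin 3)) π ≤ K ∧
        (∃ G' : ℝ → EuclideanSpace ℝ (Fin 3) →
            EuclideanSpace ℝ (Fin 3) →L[ℝ] EuclideanSpace ℝ (Fin 3),
          HasWeakSpatialGradientOn
              (parabolicCylinderOpens (2 * a) (0 : ℝ × EuclideanSpace ℝ (Fin 3))) w' G' ∧
            cknAEss a (0 : ℝ × EuclideanSpace ℝ (Fin 3)) w' +
              cknE a (0 : ℝ × EuclideanSpace ℝ (Fin 3)) G' ≤ K) ∧
        ENNReal.ofReal κ ≤ cknC a (0 : ℝ × EuclideanSpace ℝ (Fin 3)) w' := by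
  intro u w p π K κ lam hax hsing hall hsw
  obtain ⟨hax', hns, hsing', hall'⟩ := ancientLimit_poloidalPart hax hsing hall hsw
  refine ⟨fun s y => poloidalPart (w s) y, hax', hns, hsing', fun a ha => ?_, fun a ha => ?_⟩
  · exact ((ae_poloidalPart_eq_of_ae_swirl_eq_zero hsw ha).mono fun z hz => hz.symm)
  · obtain ⟨h1, h2, -, -, h5, h6, h7, h8, h9⟩ := hall' a ha
    exact ⟨h1, h2, h5, h6, h7, h8, h9⟩

end Summit.NavierStokesRegularity.NavierStokesRegularity.Theorems.AxisymmetricKatoGlobal.EulerScaling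

end
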